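import Mathlib.Data.Finset.Card
import Mathlib.Data.Finset.Union
import Mathlib.Data.Finset.Lattice.Fold
import Mathlib.Data.Fintype.Basic
import Mathlib.Data.Fintype.Card
import Mathlib.Logic.Equiv.Defs
import HarnessLib

/-!
# Hereditarily finite sets over atoms, `HF(A)`

Topic `Literature/ModelTheory/FiniteModelTheory`; support file for the CONSTRUCTION item
`defn-CPTCardProgram` (Choiceless Polynomial Time with counting, Blass–Gurevich–Shelah): the
STATES of a BGS abstract state machine live in the universe `A ∪ HF(A)` of the input structure's
elements `A`, viewed as ATOMS (urelements, objects that are not sets), together with all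
hereditarily finite sets over them (Blass–Gurevich–Shelah 1999, §4.2: "the base set consists of a
finite set of atoms and the collection HF(X) of all hereditarily finite sets built from the
atoms"; Blass–Gurevich–Shelah 2002, §2; Dawar–Richerby–Rossman 2008, §2).

Mathlib has pure well-founded sets `PSet`/`ZFSet` (no atoms, not restricted to finite sets) and
the computable ZFA lists `Lists α` (`Mathlib.SetTheory.Lists`, thin API). Coding atoms as pure
sets would let programs inspect the codes (and so distinguish, even order, the atoms), which is
exactly what CHOICELESS computation forbids; so we build the genuine object:

* `PreHF α` — pre-sets: finitely branching well-founded trees `node k (f : Fin k → PreHF α)`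
  with atoms `atom a` at some leaves (Aczel-style, as Mathlib's `PSet` but finitely indexed);
  `PreHF.Equiv` — extensional equivalence, an equivalence relation (`PreHF.setoid`).
* `HF α := Quotient PreHF.setoid` — the universe `A ∪ HF(A)`: `HF.atom a` are the atoms, every
  other element is a SET, determined by its members (`HF.ext`).
* the BGS set-theoretic primitives (loc. cit. §4.1–4.2, §4.8; 2002 §2): `∅`, membership,
  `HF.atoms` (the set `Atoms`), `HF.sUnion` (`⋃`: union of the SET members, atoms contribute
  nothing), `HF.theUnique` (the element of a singleton set, `∅` otherwise), `HF.pair`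
  (`{x, y}`), the von Neumann ordinals `HF.ordinal n`, `HF.card` (`Card`: the von Neumann
  ordinal of the number of members; atoms ↦ `0`), the truth values `false = 0 = ∅`,
  `true = 1 = {∅}` (`HF.ofBool`) and the connectives `HF.bnot/band/bor` (value `0` when an
  argument is not Boolean, loc. cit. §4.2);
* `HF.members` (the finset of members), `HF.ofFinset`/`HF.ofList` (the set with given
  members), `HF.tc` (transitive closure: members, members of members, …; used for ACTIVE
  objects, loc. cit. §5.1), `HF.rank`, and `HF.map` (the action of a relabelling of atoms,
  used for isomorphism invariance).

Everything is classical/noncomputable (`DecidableEq (HF α)` by choice): these are semantic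
objects; the SYNTAX of programs (`BGSPrograms.lean`) is the decidable part.

## References

* A. Blass, Y. Gurevich, S. Shelah, *Choiceless polynomial time*, Ann. Pure Appl. Logic 100
  (1999) 141–187 = arXiv:math/9705225, §4.1–4.2 (vocabulary, states, `HF(X)`), §4.8 (`Card`),
  §5.1 (transitive closure, active objects).
* A. Blass, Y. Gurevich, S. Shelah, *On polynomial time computation over unordered structures*,
  J. Symbolic Logic 67 (2002) 1093–1125 = arXiv:math/0102059, §2.
* A. Dawar, D. Richerby, B. Rossman, *Choiceless polynomial time, counting and the
  Cai–Fürer–Immerman graphs*, Ann. Pure Appl. Logic 152 (2008), §2–3.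
-/

noncomputable section

namespace Literature.ModelTheory.FiniteModelTheory

universe u v

/-! ### Pre-sets and extensional equivalence -/

/-- PRE-SETS over atoms `α`: `atom a` is an atom, `node k f` is the set with (pre-)members
`f 0, …, f (k-1)` (repetitions and order irrelevant up to `PreHF.Equiv`). Finitely indexed
analogue, with urelements, of Mathlib's `PSet`. [Blass–Gurevich–Shelah 1999, §4.2] [folklore] -/
inductive PreHF (α : Type u) : Type u
  /-- an atom (urelement) -/
  | atom : α → PreHF α
  /-- the set whose members are the `f i` -/
  | node : (k : ℕ) → (Fin k → PreHF α) → PreHF α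

namespace PreHF

variable {α : Type u} {β : Type v}

/-- Extensional equivalence of pre-sets: atoms are equivalent iff equal; sets iff every member of
each is equivalent to some member of the other; an atom is never equivalent to a set.
[Blass–Gurevich–Shelah 1999, §4.2] [folklore] -/
def Equiv : PreHF α → PreHF α → Prop
  | atom a, atom b => a = b
  | atom _, node _ _ => False
  | node _ _, atom _ => False
  | node _ f, node _ g => (∀ i, ∃ j, Equiv (f i) (g j)) ∧ (∀ j, ∃ i, Equiv (f i) (g j))

/-- `Equiv` is reflexive. [folklore] -/
theorem Equiv.refl : ∀ x : PreHF α, Equiv x x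
  | atom _ => rfl
  | node _ f => ⟨fun i => ⟨i, Equiv.refl (f i)⟩, fun i => ⟨i, Equiv.refl (f i)⟩⟩

/-- Euclidean property of `Equiv` (gives symmetry and transitivity). [folklore] -/
theorem Equiv.euc : ∀ {x y z : PreHF α}, Equiv x y → Equiv z y → Equiv x z
  | atom _, atom _, atom _, h1, h2 => h1.trans h2.symm
  | atom _, atom _, node _ _, _, h2 => False.elim h2
  | atom _, node _ _, _, h1, _ => False.elim h1
  | node _ _, atom _, _, h1, _ => False.elim h1
  | node _ _, node _ _, atom _, _, h2 => False.elim h2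
  | node _ _, node _ _, node _ _, ⟨fg, gf⟩, ⟨kg, gk⟩ =>
    ⟨fun i => let ⟨j, hj⟩ := fg i; let ⟨l, hl⟩ := gk j; ⟨l, Equiv.euc hj hl⟩,
     fun l => let ⟨j, hj⟩ := kg l; let ⟨i, hi⟩ := gf j; ⟨i, Equiv.euc hi hj⟩⟩

/-- `Equiv` is symmetric. [folklore] -/
theorem Equiv.symm {x y : PreHF α} (h : Equiv x y) : Equiv y x := (Equiv.refl y).euc h

/-- `Equiv` is transitive. [folklore] -/
theorem Equiv.trans {x y z : PreHF α} (h1 : Equiv x y) (h2 : Equiv y z) : Equiv x z :=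
  h1.euc h2.symm

/-- The extensional-equivalence setoid on pre-sets. [folklore] -/
instance setoid : Setoid (PreHF α) := ⟨Equiv, Equiv.refl, Equiv.symm, Equiv.trans⟩

/-- Unfolding `≈`. [folklore] -/
theorem equiv_iff {x y : PreHF α} : x ≈ y ↔ Equiv x y := Iff.rfl

/-- Atoms are equivalent iff equal. [folklore] -/
@[simp] theorem equiv_atom_atom {a b : α} : Equiv (atom a) (atom b) ↔ a = b := Iff.rfl

/-- An atom is not equivalent to a set. [folklore] -/
@[simp] theorem not_equiv_atom_node {a : α} {k : ℕ} {f : Fin k → PreHF α} :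
    ¬ Equiv (atom a) (node k f) := id

/-- A set is not equivalent to an atom. [folklore] -/
@[simp] theorem not_equiv_node_atom {a : α} {k : ℕ} {f : Fin k → PreHF α} :
    ¬ Equiv (node k f) (atom a) := id

/-- Equivalence of sets, unfolded. [folklore] -/
theorem equiv_node_node {k m : ℕ} {f : Fin k → PreHF α} {g : Fin m → PreHF α} :
    Equiv (node k f) (node m g) ↔
      (∀ i, ∃ j, Equiv (f i) (g j)) ∧ (∀ j, ∃ i, Equiv (f i) (g j)) := Iff.rfl

/-- Pre-membership: `x` is (equivalent to) one of the listed members of `y`; atoms have no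
members. [folklore] -/
def Mem (x : PreHF α) : PreHF α → Prop
  | atom _ => False
  | node _ f => ∃ i, Equiv x (f i)

/-- Pre-membership respects equivalence. [folklore] -/
theorem mem_congr {x x' y y' : PreHF α} (hx : Equiv x x') (hy : Equiv y y') :
    Mem x y ↔ Mem x' y' := by
  cases y with
  | atom a =>
    cases y' with
    | atom b => exact Iff.rfl
    | node m g => exact (not_equiv_atom_node hy).elim
  | node k f =>
    cases y' with
    | atom b => exact (not_equiv_node_atom hy).elim
    | node m g =>
      obtain ⟨fg, gf⟩ := hy
      constructor
      · rintro ⟨i, hi⟩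
        obtain ⟨j, hj⟩ := fg i
        exact ⟨j, hx.symm.trans (hi.trans hj)⟩
      · rintro ⟨j, hj⟩
        obtain ⟨i, hi⟩ := gf j
        exact ⟨i, hx.trans (hj.trans hi.symm)⟩

/-- Relabelling of atoms along a map. [folklore] -/
def map (e : α → β) : PreHF α → PreHF β
  | atom a => atom (e a)
  | node k f => node k fun i => map e (f i)

/-- Relabelling respects equivalence. [folklore] -/
theorem Equiv.map (e : α → β) : ∀ {x y : PreHF α}, Equiv x y → Equiv (map e x) (map e y)
  | atom _, atom _, h => congrArg e h
  | atom _, node _ _, h => False.elim h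
  | node _ _, atom _, h => False.elim h
  | node _ _, node _ _, ⟨fg, gf⟩ =>
    ⟨fun i => let ⟨j, hj⟩ := fg i; ⟨j, hj.map e⟩, fun j => let ⟨i, hi⟩ := gf j; ⟨i, hi.map e⟩⟩

/-- Relabelling along the identity. [folklore] -/
theorem map_id : ∀ x : PreHF α, map id x = x
  | atom _ => rfl
  | node k f => by
    show node k (fun i => map id (f i)) = node k f
    rw [funext fun i => map_id (f i)]

/-- Relabelling is functorial. [folklore] -/
theorem map_map {γ : Type*} (e : α → β) (e' : β → γ) : ∀ x : PreHF α,
    map e' (map e x) = map (e' ∘ e) x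
  | atom _ => rfl
  | node k f => by
    show node k (fun i => map e' (map e (f i))) = node k (fun i => map (e' ∘ e) (f i))
    rw [funext fun i => map_map e e' (f i)]

/-- The RANK of a pre-set: atoms (and `∅`) have rank `0`, a nonempty set has rank one more than
the maximal rank of its members. [Dawar–Richerby–Rossman 2008, §2 (rank)] [folklore] -/
def rank : PreHF α → ℕ
  | atom _ => 0
  | node _ f => Finset.univ.sup fun i => rank (f i) + 1

/-- Rank respects equivalence. [folklore] -/
theorem rank_congr : ∀ {x y : PreHF α}, Equiv x y → rank x = rank y
  | atom _, atom _, _ => rfl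
  | atom _, node _ _, h => False.elim h
  | node _ _, atom _, h => False.elim h
  | node _ f, node _ g, ⟨fg, gf⟩ => by
    apply le_antisymm
    · refine Finset.sup_le fun i _ => ?_
      obtain ⟨j, hj⟩ := fg i
      rw [rank_congr hj]
      exact Finset.le_sup (f := fun j => rank (g j) + 1) (Finset.mem_univ j)
    · refine Finset.sup_le fun j _ => ?_
      obtain ⟨i, hi⟩ := gf j
      rw [← rank_congr hi]
      exact Finset.le_sup (f := fun i => rank (f i) + 1) (Finset.mem_univ i)

end PreHF

/-! ### The universe `A ∪ HF(A)` -/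

/-- **The objects over atoms `α`**: atoms and hereditarily finite sets over them, i.e. the base
set `X ∪ HF(X)` of a BGS state (pre-sets modulo extensional equivalence).
[Blass–Gurevich–Shelah 1999, §4.2; Blass–Gurevich–Shelah 2002, §2] [cite: arXivmath9705225, §4.2] -/
def HF (α : Type u) : Type u := Quotient (PreHF.setoid (α := α))

namespace HF

variable {α : Type u} {β : Type v}

/-- The class of a pre-set. [folklore] -/
def mk (x : PreHF α) : HF α := Quotient.mk _ x

/-- Two pre-sets have the same class iff they are equivalent. [folklore] -/
theorem mk_eq_mk {x y : PreHF α} : mk x = mk y ↔ PreHF.Equiv x y := Quotient.eq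

/-- Every object is the class of a pre-set. [folklore] -/
theorem mk_surjective : Function.Surjective (mk : PreHF α → HF α) := Quotient.mk_surjective

/-- `mk` of a representative. [folklore] -/
@[simp] theorem mk_out (x : HF α) : mk (Quotient.out x) = x := Quotient.out_eq x

/-- Classical decidable equality of objects (a semantic universe; the syntax is the decidable
part). [folklore] -/
instance instDecidableEq : DecidableEq (HF α) := Classical.decEq _

/-- The ATOM `a` as an object. [Blass–Gurevich–Shelah 1999, §4.2] [folklore] -/
def atom (a : α) : HF α := mk (PreHF.atom a)

/-- `atom` is injective. [folklore] -/
theorem atom_injective : Function.Injective (atom : α → HF α) := fun _ _ h =>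
  PreHF.equiv_atom_atom.mp (mk_eq_mk.mp h)

/-- `x` IS AN ATOM. [Blass–Gurevich–Shelah 1999, §4.2] [folklore] -/
def IsAtom (x : HF α) : Prop := ∃ a, x = atom a

/-- Atoms are atoms. [folklore] -/
theorem isAtom_atom (a : α) : (atom a).IsAtom := ⟨a, rfl⟩

/-- A class of a `node` is not an atom. [folklore] -/
theorem not_isAtom_mk_node (k : ℕ) (f : Fin k → PreHF α) : ¬ (mk (PreHF.node k f)).IsAtom := by
  rintro ⟨a, h⟩
  exact PreHF.not_equiv_node_atom (mk_eq_mk.mp h)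

/-- Case analysis: an object is an atom or the class of a `node`. [folklore] -/
theorem eq_atom_or_eq_mk_node (x : HF α) :
    (∃ a, x = atom a) ∨ ∃ (k : ℕ) (f : Fin k → PreHF α), x = mk (PreHF.node k f) := by
  induction x using Quotient.inductionOn with
  | h x =>
    cases x with
    | atom a => exact Or.inl ⟨a, rfl⟩
    | node k f => exact Or.inr ⟨k, f, rfl⟩

/-- A non-atom is the class of a `node`. [folklore] -/
theorem exists_eq_mk_node_of_not_isAtom {x : HF α} (hx : ¬ x.IsAtom) :
    ∃ (k : ℕ) (f : Fin k → PreHF α), x = mk (PreHF.node k f) :=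
  (eq_atom_or_eq_mk_node x).resolve_left hx

/-- MEMBERSHIP `x ∈ s` of objects (atoms have no members). [Blass–Gurevich–Shelah 1999, §4.1
(the static predicate `∈`)] [folklore] -/
protected def Mem (s x : HF α) : Prop :=
  Quotient.liftOn₂ x s PreHF.Mem fun _ _ _ _ hx hy => propext (PreHF.mem_congr hx hy)

/-- `x ∈ s` for objects. [folklore] -/
instance instMembership : Membership (HF α) (HF α) := ⟨HF.Mem⟩

/-- Membership of classes is pre-membership. [folklore] -/
@[simp] theorem mk_mem_mk {x y : PreHF α} : mk x ∈ mk y ↔ PreHF.Mem x y := Iff.rfl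

/-- Membership in the class of a `node`, unfolded. [folklore] -/
theorem mem_mk_node {x : HF α} {k : ℕ} {f : Fin k → PreHF α} :
    x ∈ mk (PreHF.node k f) ↔ ∃ i, x = mk (f i) := by
  induction x using Quotient.inductionOn with
  | h x =>
    show PreHF.Mem x (PreHF.node k f) ↔ _
    simp only [PreHF.Mem]
    exact exists_congr fun i => mk_eq_mk.symm

/-- Atoms have no members. [Blass–Gurevich–Shelah 1999, §4.2] [folklore] -/
@[simp] theorem not_mem_atom (x : HF α) (a : α) : x ∉ atom a := by
  induction x using Quotient.inductionOn with
  | h x => exact id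

/-- An atom has no members (set-builder form). [folklore] -/
theorem IsAtom.not_mem {s : HF α} (hs : s.IsAtom) (x : HF α) : x ∉ s := by
  obtain ⟨a, rfl⟩ := hs
  exact not_mem_atom x a

/-- **Extensionality**: two SETS (non-atoms) with the same members are equal.
[Blass–Gurevich–Shelah 1999, §4.2] [folklore] -/
theorem ext {s t : HF α} (hs : ¬ s.IsAtom) (ht : ¬ t.IsAtom) (h : ∀ x, x ∈ s ↔ x ∈ t) :
    s = t := by
  obtain ⟨k, f, rfl⟩ := exists_eq_mk_node_of_not_isAtom hs
  obtain ⟨m, g, rfl⟩ := exists_eq_mk_node_of_not_isAtom ht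
  refine mk_eq_mk.mpr ⟨fun i => ?_, fun j => ?_⟩
  · obtain ⟨j, hj⟩ := mem_mk_node.mp ((h (mk (f i))).mp (mem_mk_node.mpr ⟨i, rfl⟩))
    exact ⟨j, mk_eq_mk.mp hj⟩
  · obtain ⟨i, hi⟩ := mem_mk_node.mp ((h (mk (g j))).mpr (mem_mk_node.mpr ⟨j, rfl⟩))
    exact ⟨i, (mk_eq_mk.mp hi).symm⟩

/-! ### Members, and sets with prescribed members -/

/-- The finset of members of a pre-set (as objects). [folklore] -/
def _root_.Literature.ModelTheory.FiniteModelTheory.PreHF.members : PreHF α → Finset (HF α)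
  | .atom _ => ∅
  | .node _ f => Finset.univ.image fun i => mk (f i)

/-- Membership in `PreHF.members`. [folklore] -/
theorem _root_.Literature.ModelTheory.FiniteModelTheory.PreHF.mem_members_iff {x : HF α}
    {y : PreHF α} : x ∈ y.members ↔ x ∈ mk y := by
  cases y with
  | atom a =>
    simp only [PreHF.members, Finset.notMem_empty, false_iff]
    exact not_mem_atom x a
  | node k f =>
    simp only [PreHF.members, Finset.mem_image, Finset.mem_univ, true_and, mem_mk_node]
    exact exists_congr fun i => eq_comm

/-- The finset of MEMBERS of an object (empty for atoms and for `∅`). [folklore] -/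
def members (s : HF α) : Finset (HF α) :=
  Quotient.liftOn s PreHF.members fun x y h => by
    ext z
    rw [PreHF.mem_members_iff, PreHF.mem_members_iff, show mk x = mk y from mk_eq_mk.mpr h]

/-- `x ∈ s.members ↔ x ∈ s`. [folklore] -/
@[simp] theorem mem_members {s x : HF α} : x ∈ s.members ↔ x ∈ s := by
  induction s using Quotient.inductionOn with
  | h y => exact PreHF.mem_members_iff

/-- Atoms have no members. [folklore] -/
@[simp] theorem members_atom (a : α) : (atom a).members = ∅ := rfl

/-- The SET WITH GIVEN MEMBERS, from a list of objects. [folklore] -/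
def ofList (l : List (HF α)) : HF α :=
  mk (PreHF.node l.length fun i => Quotient.out (l.get i))

/-- Membership in `ofList`. [folklore] -/
@[simp] theorem mem_ofList {l : List (HF α)} {x : HF α} : x ∈ ofList l ↔ x ∈ l := by
  rw [ofList, mem_mk_node, List.mem_iff_get]
  simp only [mk_out]
  constructor
  · rintro ⟨i, rfl⟩; exact ⟨i, rfl⟩
  · rintro ⟨i, rfl⟩; exact ⟨i, rfl⟩

/-- `ofList l` is a set, not an atom. [folklore] -/
theorem not_isAtom_ofList (l : List (HF α)) : ¬ (ofList l).IsAtom := not_isAtom_mk_node _ _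

/-- The SET WITH GIVEN MEMBERS, from a finset of objects. [folklore] -/
def ofFinset (s : Finset (HF α)) : HF α := ofList s.toList

/-- Membership in `ofFinset`. [folklore] -/
@[simp] theorem mem_ofFinset {s : Finset (HF α)} {x : HF α} : x ∈ ofFinset s ↔ x ∈ s := by
  rw [ofFinset, mem_ofList, Finset.mem_toList]

/-- `ofFinset s` is a set, not an atom. [folklore] -/
theorem not_isAtom_ofFinset (s : Finset (HF α)) : ¬ (ofFinset s).IsAtom := not_isAtom_ofList _

/-- The members of `ofFinset s` are `s`. [folklore] -/
@[simp] theorem members_ofFinset (s : Finset (HF α)) : (ofFinset s).members = s := by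
  ext x; simp

/-- A set is `ofFinset` of its members. [folklore] -/
theorem ofFinset_members {s : HF α} (hs : ¬ s.IsAtom) : ofFinset s.members = s :=
  ext (not_isAtom_ofFinset _) hs fun x => by simp

/-- Two sets are equal iff they have the same finset of members. [folklore] -/
theorem eq_iff_members_eq {s t : HF α} (hs : ¬ s.IsAtom) (ht : ¬ t.IsAtom) :
    s = t ↔ s.members = t.members :=
  ⟨fun h => h ▸ rfl, fun h => ext hs ht fun x => by rw [← mem_members, h, mem_members]⟩

/-- The EMPTY SET `∅` (which is also `false` and the ordinal `0`). [Blass–Gurevich–Shelah 1999,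
§4.1–4.2] [folklore] -/
instance instEmptyCollection : EmptyCollection (HF α) := ⟨ofFinset ∅⟩

/-- Nothing is a member of `∅`. [folklore] -/
@[simp] theorem not_mem_empty (x : HF α) : x ∉ (∅ : HF α) := by
  show x ∉ ofFinset ∅
  simp

/-- `∅` is a set, not an atom. [folklore] -/
theorem not_isAtom_empty : ¬ (∅ : HF α).IsAtom := not_isAtom_ofFinset _

/-- `∅` has no members. [folklore] -/
@[simp] theorem members_empty : (∅ : HF α).members = ∅ := members_ofFinset _

/-- An atom is not `∅`. [folklore] -/
theorem atom_ne_empty (a : α) : atom a ≠ ∅ := fun h => not_isAtom_empty (h ▸ isAtom_atom a)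

/-- A set with no members is `∅`. [folklore] -/
theorem eq_empty_of_forall_not_mem {s : HF α} (hs : ¬ s.IsAtom) (h : ∀ x, x ∉ s) : s = ∅ :=
  ext hs not_isAtom_empty fun x => by simpa using h x

/-! ### The BGS set-theoretic primitives -/

/-- `insert x s`: the set with members `x` and the members of `s` (for an atom `s`, `{x}`).
[folklore] -/
protected def insert (x s : HF α) : HF α := ofFinset (insert x s.members)

/-- Membership in `insert`. [folklore] -/
@[simp] theorem mem_insert {x s y : HF α} : y ∈ HF.insert x s ↔ y = x ∨ y ∈ s := by
  simp [HF.insert]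

/-- `insert x s` is a set. [folklore] -/
theorem not_isAtom_insert (x s : HF α) : ¬ (HF.insert x s).IsAtom := not_isAtom_ofFinset _

/-- `Pair(x, y) = {x, y}`. [Blass–Gurevich–Shelah 1999, §4.1–4.2] [cite: arXivmath9705225, §4.2] -/
def pair (x y : HF α) : HF α := ofFinset {x, y}

/-- Membership in `pair`. [folklore] -/
@[simp] theorem mem_pair {x y z : HF α} : z ∈ pair x y ↔ z = x ∨ z = y := by simp [pair]

/-- `pair x y` is a set. [folklore] -/
theorem not_isAtom_pair (x y : HF α) : ¬ (pair x y).IsAtom := not_isAtom_ofFinset _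

/-- `⋃ s`: the union of the SETS that are members of `s` (atoms among the members contribute
nothing; `⋃` of an atom is `∅`). [Blass–Gurevich–Shelah 1999, §4.2] [cite: arXivmath9705225, §4.2] -/
def sUnion (s : HF α) : HF α := ofFinset (s.members.biUnion members)

/-- Membership in `⋃ s`. [folklore] -/
@[simp] theorem mem_sUnion {s x : HF α} : x ∈ sUnion s ↔ ∃ y ∈ s, x ∈ y := by
  simp [sUnion]

/-- `⋃ s` is a set. [folklore] -/
theorem not_isAtom_sUnion (s : HF α) : ¬ (sUnion s).IsAtom := not_isAtom_ofFinset _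

/-- `TheUnique(s)`: the unique member of `s` if `s` is a singleton set, `∅` otherwise.
[Blass–Gurevich–Shelah 1999, §4.2] [cite: arXivmath9705225, §4.2] -/
def theUnique (s : HF α) : HF α := by
  classical
  exact if h : ∃ x, s.members = {x} then h.choose else ∅

/-- `TheUnique` of a singleton. [folklore] -/
theorem theUnique_eq_of_members_eq {s x : HF α} (h : s.members = {x}) : theUnique s = x := by
  classical
  have hex : ∃ x, s.members = {x} := ⟨x, h⟩
  rw [theUnique, dif_pos hex]
  exact Finset.singleton_inj.mp (hex.choose_spec.symm.trans h)

/-- `TheUnique` of a non-singleton is `∅`. [folklore] -/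
theorem theUnique_eq_empty {s : HF α} (h : ∀ x, s.members ≠ {x}) : theUnique s = ∅ := by
  classical
  rw [theUnique, dif_neg (not_exists.mpr h)]

/-- The set `Atoms` of all atoms (finite type of atoms). [Blass–Gurevich–Shelah 1999, §4.1–4.2]
[cite: arXivmath9705225, §4.2] -/
def atoms [Fintype α] : HF α := ofFinset (Finset.univ.image atom)

/-- Membership in `Atoms`. [folklore] -/
@[simp] theorem mem_atoms [Fintype α] {x : HF α} : x ∈ (atoms : HF α) ↔ x.IsAtom := by
  simp only [atoms, mem_ofFinset, Finset.mem_image, Finset.mem_univ, true_and, IsAtom]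
  exact exists_congr fun a => eq_comm

/-! ### Von Neumann ordinals, `Card`, Booleans -/

/-- The von Neumann ordinal `n = {0, 1, …, n-1}` (`0 = ∅`, `n + 1 = n ∪ {n}`).
[Blass–Gurevich–Shelah 2002, §2 ("HF(I) contains the natural numbers, coded as von Neumann
ordinals")] [folklore] -/
def ordinal : ℕ → HF α
  | 0 => ∅
  | n + 1 => HF.insert (ordinal n) (ordinal n)

/-- `ordinal 0 = ∅`. [folklore] -/
@[simp] theorem ordinal_zero : (ordinal 0 : HF α) = ∅ := rfl

/-- `ordinal (n+1) = insert (ordinal n) (ordinal n)`. [folklore] -/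
theorem ordinal_succ (n : ℕ) : (ordinal (n + 1) : HF α) = HF.insert (ordinal n) (ordinal n) := rfl

/-- Ordinals are sets. [folklore] -/
theorem not_isAtom_ordinal : ∀ n : ℕ, ¬ (ordinal n : HF α).IsAtom
  | 0 => not_isAtom_empty
  | _ + 1 => not_isAtom_insert _ _

/-- Membership in a von Neumann ordinal: `x ∈ n ↔ x = m` for some `m < n`. [folklore] -/
theorem mem_ordinal_iff {n : ℕ} {x : HF α} : x ∈ (ordinal n : HF α) ↔ ∃ m < n, x = ordinal m := by
  induction n with
  | zero => simp
  | succ n ih =>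
    rw [ordinal_succ, mem_insert, ih]
    constructor
    · rintro (rfl | ⟨m, hm, rfl⟩)
      · exact ⟨n, n.lt_succ_self, rfl⟩
      · exact ⟨m, Nat.lt_succ_of_lt hm, rfl⟩
    · rintro ⟨m, hm, rfl⟩
      rcases Nat.lt_succ_iff_lt_or_eq.mp hm with h | rfl
      · exact Or.inr ⟨m, h, rfl⟩
      · exact Or.inl rfl

/-- The RANK of an object (atoms and `∅` have rank `0`; a nonempty set, one more than the
maximal rank of its members). [Dawar–Richerby–Rossman 2008, §2] [folklore] -/
def rank (x : HF α) : ℕ := Quotient.liftOn x PreHF.rank fun _ _ h => PreHF.rank_congr h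

/-- A member has smaller rank. [folklore] -/
theorem rank_lt_of_mem {x s : HF α} (h : x ∈ s) : rank x < rank s := by
  induction s using Quotient.inductionOn with
  | h y =>
    induction x using Quotient.inductionOn with
    | h x =>
      cases y with
      | atom a => exact (not_mem_atom (mk x) a h).elim
      | node k f =>
        obtain ⟨i, hi⟩ := (mem_mk_node (x := mk x)).mp h
        have hx : rank (mk x) = PreHF.rank (f i) := PreHF.rank_congr (mk_eq_mk.mp hi)
        show PreHF.rank x < Finset.univ.sup fun i => PreHF.rank (f i) + 1
        change rank (mk x) < _
        rw [hx]
        exact Finset.le_sup (f := fun i => PreHF.rank (f i) + 1) (Finset.mem_univ i)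

/-- Membership is irreflexive. [folklore] -/
theorem not_mem_self (x : HF α) : x ∉ x := fun h => lt_irrefl _ (rank_lt_of_mem h)

/-- The rank of the ordinal `n` is `n`. [folklore] -/
theorem rank_ordinal : ∀ n : ℕ, rank (ordinal n : HF α) = n := by
  -- ranks of `ofFinset`
  have key : ∀ s : Finset (HF α), rank (ofFinset s) = s.sup fun x => rank x + 1 := by
    intro s
    show (Finset.univ.sup fun i : Fin s.toList.length =>
        PreHF.rank (Quotient.out (s.toList.get i)) + 1) = _
    apply le_antisymm
    · refine Finset.sup_le fun i _ => ?_
      have hmem : s.toList.get i ∈ s := Finset.mem_toList.mp (List.get_mem _ _)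
      have : PreHF.rank (Quotient.out (s.toList.get i)) = rank (s.toList.get i) := by
        conv_rhs => rw [← Quotient.out_eq (s.toList.get i)]
        rfl
      rw [this]
      exact Finset.le_sup (f := fun x => rank x + 1) hmem
    · refine Finset.sup_le fun x hx => ?_
      obtain ⟨i, hi⟩ := List.mem_iff_get.mp (Finset.mem_toList.mpr hx)
      have : rank x = PreHF.rank (Quotient.out (s.toList.get i)) := by
        rw [← hi]
        conv_lhs => rw [← Quotient.out_eq (s.toList.get i)]
        rfl
      rw [this]
      exact Finset.le_sup (f := fun i => PreHF.rank (Quotient.out (s.toList.get i)) + 1)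
        (Finset.mem_univ i)
  intro n
  induction n with
  | zero => show rank (ofFinset ∅) = 0; rw [key]; rfl
  | succ n ih =>
    rw [ordinal_succ, HF.insert, key, Finset.sup_insert, ih]
    apply le_antisymm
    · refine sup_le le_rfl (Finset.sup_le fun x hx => ?_)
      have := rank_lt_of_mem (mem_members.mp hx)
      rw [ih] at this
      omega
    · exact le_sup_left

/-- `ordinal` is injective. [folklore] -/
theorem ordinal_injective : Function.Injective (ordinal : ℕ → HF α) := fun m n h => by
  rw [← rank_ordinal (α := α) m, h, rank_ordinal]

/-- The members of `ordinal n` are the `ordinal m`, `m < n`. [folklore] -/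
theorem members_ordinal (n : ℕ) :
    (ordinal n : HF α).members = (Finset.range n).image ordinal := by
  ext x
  simp only [mem_members, mem_ordinal_iff, Finset.mem_image, Finset.mem_range]
  constructor
  · rintro ⟨m, hm, rfl⟩; exact ⟨m, hm, rfl⟩
  · rintro ⟨m, hm, rfl⟩; exact ⟨m, hm, rfl⟩

/-- `ordinal n` has exactly `n` members. [folklore] -/
theorem card_members_ordinal (n : ℕ) : (ordinal n : HF α).members.card = n := by
  rw [members_ordinal, Finset.card_image_of_injective _ ordinal_injective, Finset.card_range]

/-- A successor ordinal is not `∅`. [folklore] -/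
@[simp] theorem ordinal_succ_ne_empty (n : ℕ) : (ordinal (n + 1) : HF α) ≠ ∅ := fun h =>
  Nat.succ_ne_zero n (ordinal_injective (h.trans ordinal_zero.symm))

/-- `∅` is not a successor ordinal. [folklore] -/
@[simp] theorem empty_ne_ordinal_succ (n : ℕ) : (∅ : HF α) ≠ ordinal (n + 1) :=
  (ordinal_succ_ne_empty n).symm

/-- `ordinal m = ordinal n ↔ m = n`. [folklore] -/
@[simp] theorem ordinal_inj {m n : ℕ} : (ordinal m : HF α) = ordinal n ↔ m = n :=
  ordinal_injective.eq_iff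

/-- `Card(s)`: the von Neumann ordinal of the number of members of `s` (so atoms and `∅` are sent
to `0`). [Blass–Gurevich–Shelah 1999, §4.8; Blass–Gurevich–Shelah 2002, §2 ("Card sends every set
to its cardinality … and sends atoms to 0")] [cite: arXivmath9705225, §4.8] -/
def card (s : HF α) : HF α := ordinal s.members.card

/-- `Card` of an atom is `0`. [Blass–Gurevich–Shelah 2002, §2] [folklore] -/
@[simp] theorem card_atom (a : α) : card (atom a) = ∅ := by simp [card]

/-- `Card` of the ordinal `n` is `n`. [folklore] -/
@[simp] theorem card_ordinal (n : ℕ) : card (ordinal n : HF α) = ordinal n := by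
  rw [card, card_members_ordinal]

/-- The truth values: `false = 0 = ∅`, `true = 1 = {∅}`. [Blass–Gurevich–Shelah 1999, §4.2
("false and true are interpreted as 0 and 1")] [cite: arXivmath9705225, §4.2] -/
def ofBool (b : Bool) : HF α := if b then ordinal 1 else ordinal 0

/-- `ofBool false = ∅`. [folklore] -/
theorem ofBool_false : (ofBool false : HF α) = ∅ := rfl

/-- `ofBool true = ordinal 1 = {∅}`. [folklore] -/
theorem ofBool_true : (ofBool true : HF α) = ordinal 1 := rfl

/-- `ofBool` is injective (`0 ≠ 1`). [folklore] -/
theorem ofBool_injective : Function.Injective (ofBool : Bool → HF α) := by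
  intro b c h
  cases b <;> cases c
  · rfl
  · exact absurd (ordinal_injective (h : (ordinal 0 : HF α) = ordinal 1)) (by decide)
  · exact absurd (ordinal_injective (h : (ordinal 1 : HF α) = ordinal 0)) (by decide)
  · rfl

/-- `ofBool b = ofBool true ↔ b = true`. [folklore] -/
@[simp] theorem ofBool_eq_ofBool_iff {b c : Bool} : (ofBool b : HF α) = ofBool c ↔ b = c :=
  ofBool_injective.eq_iff

/-- `x` IS BOOLEAN: `x ∈ {0, 1}`. [Blass–Gurevich–Shelah 1999, §4.2] [folklore] -/
def IsBool (x : HF α) : Prop := ∃ b, x = ofBool b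

/-- Truth values are Boolean. [folklore] -/
@[simp] theorem isBool_ofBool (b : Bool) : (ofBool b : HF α).IsBool := ⟨b, rfl⟩

/-- `∅ = false` is Boolean. [folklore] -/
@[simp] theorem isBool_empty : (∅ : HF α).IsBool := ⟨false, rfl⟩

/-- `1 = true` is Boolean. [folklore] -/
@[simp] theorem isBool_ordinal_one : (ordinal 1 : HF α).IsBool := ⟨true, rfl⟩

/-- NEGATION on objects: `¬1 = 0`, `¬0 = 1`, and `0` on non-Boolean arguments.
[Blass–Gurevich–Shelah 1999, §4.2 ("the Boolean connectives … take the value 0 if at least one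
of the arguments is not Boolean")] [cite: arXivmath9705225, §4.2] -/
def bnot (x : HF α) : HF α := ofBool (decide (x = ofBool false))

/-- CONJUNCTION on objects (`0` unless both arguments are `1`). [Blass–Gurevich–Shelah 1999,
§4.2] [cite: arXivmath9705225, §4.2] -/
def band (x y : HF α) : HF α := ofBool (decide (x = ofBool true ∧ y = ofBool true))

/-- DISJUNCTION on objects (`1` iff both arguments are Boolean and one is `1`; `0` if an argument
is not Boolean). [Blass–Gurevich–Shelah 1999, §4.2] [cite: arXivmath9705225, §4.2] -/
def bor (x y : HF α) : HF α := by
  classical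
  exact ofBool (decide (IsBool x ∧ IsBool y ∧ (x = ofBool true ∨ y = ofBool true)))

/-- `bnot` on truth values. [folklore] -/
@[simp] theorem bnot_ofBool (b : Bool) : bnot (ofBool b : HF α) = ofBool (!b) := by
  cases b <;> simp [bnot]

/-- `band` on truth values. [folklore] -/
@[simp] theorem band_ofBool (b c : Bool) : band (ofBool b : HF α) (ofBool c) = ofBool (b && c) := by
  cases b <;> cases c <;> simp [band]

/-- `bor` on truth values. [folklore] -/
@[simp] theorem bor_ofBool (b c : Bool) : bor (ofBool b : HF α) (ofBool c) = ofBool (b || c) := by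
  classical
  unfold bor
  cases b <;> cases c <;> simp

/-! ### Transitive closure -/

/-- The hereditary members of a pre-set (members, their members, …), as objects. [folklore] -/
def _root_.Literature.ModelTheory.FiniteModelTheory.PreHF.tc : PreHF α → Finset (HF α)
  | .atom _ => ∅
  | .node _ f => Finset.univ.biUnion fun i => insert (mk (f i)) (PreHF.tc (f i))

/-- `PreHF.tc` respects equivalence. [folklore] -/
theorem _root_.Literature.ModelTheory.FiniteModelTheory.PreHF.tc_congr :
    ∀ {x y : PreHF α}, PreHF.Equiv x y → x.tc = y.tc
  | .atom _, .atom _, _ => rfl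
  | .atom _, .node _ _, h => False.elim h
  | .node _ _, .atom _, h => False.elim h
  | .node _ f, .node _ g, ⟨fg, gf⟩ => by
    apply subset_antisymm
    · intro z hz
      simp only [PreHF.tc, Finset.mem_biUnion, Finset.mem_univ, true_and] at hz ⊢
      obtain ⟨i, hi⟩ := hz
      obtain ⟨j, hj⟩ := fg i
      refine ⟨j, ?_⟩
      rwa [← PreHF.tc_congr hj, ← show mk (f i) = mk (g j) from mk_eq_mk.mpr hj]
    · intro z hz
      simp only [PreHF.tc, Finset.mem_biUnion, Finset.mem_univ, true_and] at hz ⊢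
      obtain ⟨j, hj⟩ := hz
      obtain ⟨i, hi⟩ := gf j
      refine ⟨i, ?_⟩
      rwa [PreHF.tc_congr hi, show mk (f i) = mk (g j) from mk_eq_mk.mpr hi]

/-- The TRANSITIVE CLOSURE `TC(x)` of an object as a finset: its members, their members, and so
on (`x` itself excluded; empty for atoms). [Blass–Gurevich–Shelah 1999, §5.1 (active objects:
`x ∈ TC(y)` for a critical `y`)] [cite: arXivmath9705225, §5.1] -/
def tc (x : HF α) : Finset (HF α) := Quotient.liftOn x PreHF.tc fun _ _ h => PreHF.tc_congr h

/-- Membership in the transitive closure: a member, or hereditarily a member of a member.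
[folklore] -/
theorem mem_tc_iff {x z : HF α} : z ∈ tc x ↔ ∃ y ∈ x, z = y ∨ z ∈ tc y := by
  obtain ⟨x, rfl⟩ := mk_surjective x
  cases x with
  | atom a =>
    show z ∈ (∅ : Finset (HF α)) ↔ ∃ y ∈ atom a, z = y ∨ z ∈ tc y
    simp only [Finset.notMem_empty, false_iff, not_exists, not_and]
    exact fun y hy => (not_mem_atom y a hy).elim
  | node k f =>
    show z ∈ (Finset.univ.biUnion fun i => insert (mk (f i)) (PreHF.tc (f i))) ↔
      ∃ y ∈ mk (PreHF.node k f), z = y ∨ z ∈ tc y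
    simp only [Finset.mem_biUnion, Finset.mem_univ, true_and, Finset.mem_insert]
    constructor
    · rintro ⟨i, hi⟩
      exact ⟨mk (f i), mem_mk_node.mpr ⟨i, rfl⟩, hi⟩
    · rintro ⟨y, hy, h⟩
      obtain ⟨i, rfl⟩ := mem_mk_node.mp hy
      exact ⟨i, h⟩

/-- Members are in the transitive closure. [folklore] -/
theorem mem_tc_of_mem {x y : HF α} (h : y ∈ x) : y ∈ tc x := mem_tc_iff.mpr ⟨y, h, Or.inl rfl⟩

/-- The transitive closure is transitive. [folklore] -/
theorem tc_subset_tc_of_mem {x y : HF α} (h : y ∈ x) : tc y ⊆ tc x := fun _ hz =>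
  mem_tc_iff.mpr ⟨y, h, Or.inr hz⟩

/-- Atoms have empty transitive closure. [folklore] -/
@[simp] theorem tc_atom (a : α) : tc (atom a) = ∅ := rfl

/-! ### Relabelling the atoms (for isomorphism invariance) -/

/-- The action of a relabelling `e : α → β` of atoms on objects. [Blass–Gurevich–Shelah 1999,
§4.3 (the initial state is unique up to isomorphism); §8 (automorphisms act on `HF(I)`)]
[folklore] -/
def map (e : α → β) (x : HF α) : HF β :=
  Quotient.liftOn x (fun y => mk (PreHF.map e y)) fun _ _ h => mk_eq_mk.mpr (h.map e)

/-- `map` on classes. [folklore] -/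
@[simp] theorem map_mk (e : α → β) (x : PreHF α) : map e (mk x) = mk (PreHF.map e x) := rfl

/-- `map` on atoms. [folklore] -/
@[simp] theorem map_atom (e : α → β) (a : α) : map e (atom a) = atom (e a) := rfl

/-- `map id = id`. [folklore] -/
@[simp] theorem map_id (x : HF α) : map id x = x := by
  induction x using Quotient.inductionOn with
  | h x => exact congrArg mk (PreHF.map_id x)

/-- Functoriality of `map`. [folklore] -/
theorem map_map {γ : Type*} (e : α → β) (e' : β → γ) (x : HF α) :
    map e' (map e x) = map (e' ∘ e) x := by
  induction x using Quotient.inductionOn with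
  | h x => exact congrArg mk (PreHF.map_map e e' x)

/-- Membership is transported by `map` along an equivalence. [folklore] -/
theorem mem_map_iff (e : α ≃ β) {x : HF α} {z : HF β} :
    z ∈ map e x ↔ ∃ y ∈ x, map e y = z := by
  obtain ⟨x, rfl⟩ := mk_surjective x
  cases x with
  | atom a =>
    show z ∈ atom (e a) ↔ ∃ y ∈ atom a, map e y = z
    constructor
    · exact fun h => (not_mem_atom z (e a) h).elim
    · rintro ⟨y, hy, -⟩; exact (not_mem_atom y a hy).elim
  | node k f =>
    show z ∈ mk (PreHF.node k fun i => PreHF.map e (f i)) ↔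
      ∃ y ∈ mk (PreHF.node k f), map e y = z
    rw [mem_mk_node]
    constructor
    · rintro ⟨i, rfl⟩
      exact ⟨mk (f i), mem_mk_node.mpr ⟨i, rfl⟩, rfl⟩
    · rintro ⟨y, hy, rfl⟩
      obtain ⟨i, rfl⟩ := mem_mk_node.mp hy
      exact ⟨i, rfl⟩

/-- `map` along an equivalence is a bijection with inverse `map e.symm`. [folklore] -/
theorem map_symm_map (e : α ≃ β) (x : HF α) : map e.symm (map e x) = x := by
  rw [map_map, Equiv.symm_comp_self]; exact map_id x

/-- See `map_symm_map`. [folklore] -/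
theorem map_map_symm (e : α ≃ β) (x : HF β) : map e (map e.symm x) = x := by
  rw [map_map, Equiv.self_comp_symm]; exact map_id x

/-- `map` along an equivalence is injective. [folklore] -/
theorem map_injective (e : α ≃ β) : Function.Injective (map e : HF α → HF β) := fun x y h => by
  rw [← map_symm_map e x, h, map_symm_map]

/-- `map` preserves membership. [folklore] -/
theorem map_mem_map_iff (e : α ≃ β) {x y : HF α} : map e y ∈ map e x ↔ y ∈ x := by
  rw [mem_map_iff]
  constructor
  · rintro ⟨y', hy', h⟩
    rwa [← map_injective e h]
  · exact fun h => ⟨y, h, rfl⟩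

/-- `map` preserves atomhood. [folklore] -/
theorem isAtom_map_iff (e : α ≃ β) {x : HF α} : (map e x).IsAtom ↔ x.IsAtom := by
  constructor
  · rintro ⟨b, hb⟩
    refine ⟨e.symm b, ?_⟩
    rw [← map_symm_map e x, hb, map_atom]
  · rintro ⟨a, rfl⟩
    exact ⟨e a, rfl⟩

/-- `map` commutes with `members`. [folklore] -/
theorem members_map (e : α ≃ β) (x : HF α) : (map e x).members = x.members.image (map e) := by
  ext z
  simp only [mem_members, mem_map_iff, Finset.mem_image]

/-- `map` commutes with `ofFinset`. [folklore] -/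
theorem map_ofFinset (e : α ≃ β) (s : Finset (HF α)) :
    map e (ofFinset s) = ofFinset (s.image (map e)) := by
  refine ext ((isAtom_map_iff e).not.mpr (not_isAtom_ofFinset s)) (not_isAtom_ofFinset _)
    fun z => ?_
  simp only [mem_map_iff, mem_ofFinset, Finset.mem_image]

/-- `map` fixes `∅`. [folklore] -/
@[simp] theorem map_empty (e : α ≃ β) : map e (∅ : HF α) = ∅ := by
  show map e (ofFinset ∅) = ofFinset ∅
  rw [map_ofFinset]; rfl

/-- `map` commutes with `insert`. [folklore] -/
theorem map_insert (e : α ≃ β) (x s : HF α) :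
    map e (HF.insert x s) = HF.insert (map e x) (map e s) := by
  rw [HF.insert, HF.insert, map_ofFinset, Finset.image_insert, members_map]

/-- `map` commutes with `pair`. [folklore] -/
theorem map_pair (e : α ≃ β) (x y : HF α) : map e (pair x y) = pair (map e x) (map e y) := by
  rw [pair, pair, map_ofFinset, Finset.image_insert, Finset.image_singleton]

/-- `map` commutes with `⋃`. [folklore] -/
theorem map_sUnion (e : α ≃ β) (s : HF α) : map e (sUnion s) = sUnion (map e s) := by
  refine ext ((isAtom_map_iff e).not.mpr (not_isAtom_sUnion s)) (not_isAtom_sUnion _) fun z => ?_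
  constructor
  · intro hz
    obtain ⟨y, hy, rfl⟩ := (mem_map_iff e).mp hz
    obtain ⟨w, hw, hyw⟩ := mem_sUnion.mp hy
    exact mem_sUnion.mpr ⟨map e w, (map_mem_map_iff e).mpr hw, (map_mem_map_iff e).mpr hyw⟩
  · intro hz
    obtain ⟨w, hw, hzw⟩ := mem_sUnion.mp hz
    obtain ⟨w', hw', rfl⟩ := (mem_map_iff e).mp hw
    obtain ⟨z', hz', rfl⟩ := (mem_map_iff e).mp hzw
    exact (map_mem_map_iff e).mpr (mem_sUnion.mpr ⟨w', hw', hz'⟩)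

/-- `map` fixes the von Neumann ordinals. [folklore] -/
@[simp] theorem map_ordinal (e : α ≃ β) : ∀ n : ℕ, map e (ordinal n : HF α) = ordinal n
  | 0 => map_empty e
  | n + 1 => by rw [ordinal_succ, ordinal_succ, map_insert, map_ordinal e n]

/-- `map` fixes the truth values. [folklore] -/
@[simp] theorem map_ofBool (e : α ≃ β) (b : Bool) : map e (ofBool b : HF α) = ofBool b := by
  cases b
  · rw [ofBool_false, ofBool_false, map_empty]
  · rw [ofBool_true, ofBool_true, map_ordinal]

/-- `map e x` is a truth value iff `x` is that truth value. [folklore] -/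
@[simp] theorem map_eq_ofBool_iff (e : α ≃ β) {x : HF α} {b : Bool} :
    map e x = ofBool b ↔ x = ofBool b := by
  rw [← map_ofBool e b, (map_injective e).eq_iff]

/-- `map` preserves Booleanness. [folklore] -/
@[simp] theorem isBool_map_iff (e : α ≃ β) {x : HF α} : (map e x).IsBool ↔ x.IsBool := by
  simp only [IsBool, map_eq_ofBool_iff]

/-- `map` preserves the number of members. [folklore] -/
theorem card_members_map (e : α ≃ β) (x : HF α) : (map e x).members.card = x.members.card := by
  rw [members_map, Finset.card_image_of_injective _ (map_injective e)]

/-- `map` commutes with `Card`. [folklore] -/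
theorem map_card (e : α ≃ β) (x : HF α) : map e (card x) = card (map e x) := by
  rw [card, card, map_ordinal, card_members_map]

/-- `map` commutes with `TheUnique`. [folklore] -/
theorem map_theUnique (e : α ≃ β) (s : HF α) : map e (theUnique s) = theUnique (map e s) := by
  by_cases h : ∃ x, s.members = {x}
  · obtain ⟨x, hx⟩ := h
    have hx' : (map e s).members = {map e x} := by rw [members_map, hx, Finset.image_singleton]
    rw [theUnique_eq_of_members_eq hx, theUnique_eq_of_members_eq hx']
  · rw [theUnique_eq_empty (not_exists.mp h), map_empty, theUnique_eq_empty]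
    intro y hy
    rw [members_map] at hy
    obtain ⟨x, hx, rfl⟩ : ∃ x ∈ s.members, map e x = y := by
      have : y ∈ s.members.image (map e) := by rw [hy]; exact Finset.mem_singleton_self _
      simpa using this
    refine h ⟨x, Finset.eq_singleton_iff_unique_mem.mpr ⟨hx, fun z hz => map_injective e ?_⟩⟩
    have : map e z ∈ s.members.image (map e) := Finset.mem_image_of_mem _ hz
    rw [hy] at this
    exact Finset.mem_singleton.mp this

/-- `map` commutes with `bnot`. [folklore] -/
theorem map_bnot (e : α ≃ β) (x : HF α) : map e (bnot x) = bnot (map e x) := by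
  simp only [bnot, map_ofBool, map_eq_ofBool_iff]

/-- `map` commutes with `band`. [folklore] -/
theorem map_band (e : α ≃ β) (x y : HF α) : map e (band x y) = band (map e x) (map e y) := by
  simp only [band, map_ofBool, map_eq_ofBool_iff]

/-- `map` commutes with `bor`. [folklore] -/
theorem map_bor (e : α ≃ β) (x y : HF α) : map e (bor x y) = bor (map e x) (map e y) := by
  classical
  unfold bor
  simp only [map_ofBool, map_eq_ofBool_iff, isBool_map_iff]

/-- `map` along an equivalence of finite types of atoms fixes `Atoms`. [folklore] -/
theorem map_atoms [Fintype α] [Fintype β] (e : α ≃ β) : map e (atoms : HF α) = atoms := by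
  refine ext ((isAtom_map_iff e).not.mpr (not_isAtom_ofFinset _)) (not_isAtom_ofFinset _) fun z => ?_
  rw [mem_map_iff, mem_atoms]
  constructor
  · rintro ⟨y, hy, rfl⟩
    exact (isAtom_map_iff e).mpr (mem_atoms.mp hy)
  · rintro ⟨b, rfl⟩
    exact ⟨atom (e.symm b), mem_atoms.mpr (isAtom_atom _), by rw [map_atom, Equiv.apply_symm_apply]⟩

/-- `map` commutes with transitive closure. [folklore] -/
theorem tc_map (e : α ≃ β) (x : HF α) : (map e x).tc = x.tc.image (map e) := by
  -- by induction on the rank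
  suffices h : ∀ (r : ℕ) (x : HF α), rank x ≤ r → (map e x).tc = x.tc.image (map e) from
    h _ x le_rfl
  intro r
  induction r with
  | zero =>
    intro x hx
    ext z
    rw [Finset.mem_image, mem_tc_iff]
    constructor
    · rintro ⟨y, hy, -⟩
      obtain ⟨y', hy', rfl⟩ := (mem_map_iff e).mp hy
      exact absurd (rank_lt_of_mem hy') (by omega)
    · rintro ⟨w, hw, rfl⟩
      obtain ⟨y, hy, -⟩ := mem_tc_iff.mp hw
      exact absurd (rank_lt_of_mem hy) (by omega)
  | succ r ih =>
    intro x hx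
    ext z
    rw [Finset.mem_image, mem_tc_iff]
    constructor
    · rintro ⟨y, hy, hz⟩
      obtain ⟨y', hy', rfl⟩ := (mem_map_iff e).mp hy
      have hr : rank y' ≤ r := Nat.lt_succ_iff.mp (lt_of_lt_of_le (rank_lt_of_mem hy') hx)
      rcases hz with rfl | hz
      · exact ⟨y', mem_tc_of_mem hy', rfl⟩
      · rw [ih y' hr, Finset.mem_image] at hz
        obtain ⟨w, hw, rfl⟩ := hz
        exact ⟨w, tc_subset_tc_of_mem hy' hw, rfl⟩
    · rintro ⟨w, hw, rfl⟩
      obtain ⟨y, hy, hw'⟩ := mem_tc_iff.mp hw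
      have hr : rank y ≤ r := Nat.lt_succ_iff.mp (lt_of_lt_of_le (rank_lt_of_mem hy) hx)
      refine ⟨map e y, (map_mem_map_iff e).mpr hy, ?_⟩
      rcases hw' with rfl | hw'
      · exact Or.inl rfl
      · exact Or.inr (by rw [ih y hr]; exact Finset.mem_image_of_mem _ hw')

end HF

end Literature.ModelTheory.FiniteModelTheory
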